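import Mathlib
import Summits.NavierStokesRegularity.NavierStokesRegularity.Theorems.LerayQuarterDissipationFiniteDissipationLiouvilleSmallDissipationGapBudget
import HarnessLib

/-!
# Small-dissipation gap for the finite-dissipation stratum, SHARPER CONSTANT, file 1/3: the
  Ladyzhenskaya stretching bound with free weights (route `LerayQuarterDissipation`, crux
  `FiniteDissipationLiouville` stmt-NavierStokesRegularity-22144, BC5 rung `stub_smallDissipationGap`;
  lead prover g14, helper)

HONEST FRAMING. Label-free analysis helper about a HYPOTHETICAL object (a Type-I ancient mild field
in the KNSS gauge) under the additional hypothesis `∫‖DU(s)‖² ≤ K_U` on the similarity slices.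
Nothing here bears on Navier–Stokes regularity or blow-up; no summit is proved.

CONTENTS. The tree's `SmallDissipationGap.two_mul_integral_sqCutoff_stretching_le` (seat ns-lqd-p2)
prices the stretching term as `2∫φ²⟪DUΩ,Ω⟫ ≤ (θ/2)Z_R + 3θ∫φ²‖∇Ω‖² + 3θ(c₁/R)²I` — Young
`4ab³ ≤ a⁴ + 3b⁴` with EQUAL weights and the crude product rule `‖D(φΩ)‖² ≤ 2φ²‖DΩ‖² + 2‖Dφ‖²‖Ω‖²`
— whence the gap needs `θ = √K_U (√K_S)³ ≤ 2/3`. Here the same chain with free parameters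
`δ, m > 0` (`two_mul_integral_sqCutoff_stretching_le_weighted`):
  `2∫φ²⟪DUΩ,Ω⟫ ≤ (θ m¹²/2) Z_R + (3θ/(2m⁴))(1+δ)∫φ²‖∇Ω‖²_F + (3θ/(2m⁴))(1+δ⁻¹)(c₁/R)²I`
(`‖D(φΩ)‖² ≤ (1+δ)φ²‖DΩ‖² + (1+δ⁻¹)‖Dφ‖²‖Ω‖²`, `4ab³ = 4(m³a)(b/m)³ ≤ m¹²a⁴ + 3b⁴/m⁴`).
File 2/3 (`…SmallDissipationGapSharperBudget`) optimises the weights into the budget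
`Z_R' ≤ −κ Z_R + (L/R)∫_{B̄_{2R}}‖Ω‖²` for every `θ⁴ < 64/27`; file 3/3 the Liouville theorem.
[folklore energy method; Ladyzhenskaya's inequality]
-/

noncomputable section

set_option linter.dupNamespace false

namespace Summit.NavierStokesRegularity.NavierStokesRegularity.Theorems.SmallDissipationGap

open MeasureTheory Set Filter Topology Metric InnerProductSpace Function Real
open scoped RealInnerProductSpace Laplacian ContDiff
open Literature.Analysis Literature.Analysis.FluidPDE
open Summit.NavierStokesRegularity.NavierStokesRegularity.Theorems
open Summit.NavierStokesRegularity.NavierStokesRegularity.Theorems.GaussianGap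
open Summit.NavierStokesRegularity.NavierStokesRegularity.Theorems.SimilarityEnstrophy

variable {C : ℝ} {V : ℝ → (EuclideanSpace ℝ (Fin 3)) → (EuclideanSpace ℝ (Fin 3))}

/-! ### The stretching term with free weights -/

/-- **Scalar assembly of the weighted stretching bound** (pure real arithmetic). From
`S ≤ √J·√I₄` (Cauchy–Schwarz), `√I₄ ≤ k³ab³` (Ladyzhenskaya, fourth roots `a⁴ = A`, `b⁴ = B`),
`√J ≤ √K`, the weighted product rule `B ≤ (1+δ)D + (1+δ⁻¹)(c/R)²I` and the weighted Young inequality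
`4ab³ = 4(m³a)(b/m)³ ≤ m¹²a⁴ + 3b⁴/m⁴`:
`2S ≤ (√K k³ m¹²/2) A + (3√K k³/(2m⁴))(1+δ) D + (3√K k³/(2m⁴))(1+δ⁻¹)(c/R)² I`. [folklore] -/
theorem two_mul_le_of_weightedYoung {S J I₄ K k a b m δ A B D I c R : ℝ}
    (hk : 0 ≤ k) (ha : 0 ≤ a) (hb : 0 ≤ b) (hm : 0 < m)
    (hS : S ≤ Real.sqrt J * Real.sqrt I₄) (hs4 : Real.sqrt I₄ ≤ k ^ 3 * a * b ^ 3)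
    (hJK : Real.sqrt J ≤ Real.sqrt K) (hAa : A = a ^ 4) (hBb : B = b ^ 4)
    (hB : B ≤ (1 + δ) * D + (1 + δ⁻¹) * ((c / R) ^ 2 * I)) :
    2 * S ≤ (Real.sqrt K * k ^ 3 * m ^ 12 / 2) * A + (3 * (Real.sqrt K * k ^ 3) / (2 * m ^ 4)) * (1 + δ) * D +
      (3 * (Real.sqrt K * k ^ 3) / (2 * m ^ 4)) * (1 + δ⁻¹) * (c / R) ^ 2 * I := by
  have hY : 4 * (a * b ^ 3) ≤ m ^ 12 * a ^ 4 + 3 * b ^ 4 / m ^ 4 := by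
    have h := four_mul_mul_cube_le (a := m ^ 3 * a) (b := b / m) (by positivity) (by positivity)
    have hm4 : m ^ 4 ≠ 0 := by positivity
    have e1 : 4 * (m ^ 3 * a * (b / m) ^ 3) = 4 * (a * b ^ 3) := by
      field_simp
    have e2 : (m ^ 3 * a) ^ 4 + 3 * (b / m) ^ 4 = m ^ 12 * a ^ 4 + 3 * b ^ 4 / m ^ 4 := by
      field_simp
    rw [e1, e2] at h
    exact h
  have hI40 : 0 ≤ Real.sqrt I₄ := Real.sqrt_nonneg _
  have hK0 : 0 ≤ Real.sqrt K := Real.sqrt_nonneg _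
  have hmain : 2 * (Real.sqrt J * Real.sqrt I₄) ≤
      (Real.sqrt K * k ^ 3 * m ^ 12 / 2) * A + (3 * (Real.sqrt K * k ^ 3) / (2 * m ^ 4)) * B := by
    calc 2 * (Real.sqrt J * Real.sqrt I₄) ≤ 2 * (Real.sqrt K * (k ^ 3 * a * b ^ 3)) := by
          gcongr
      _ = (Real.sqrt K * k ^ 3 / 2) * (4 * (a * b ^ 3)) := by ring
      _ ≤ (Real.sqrt K * k ^ 3 / 2) * (m ^ 12 * a ^ 4 + 3 * b ^ 4 / m ^ 4) :=
          mul_le_mul_of_nonneg_left hY (by positivity)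
      _ = (Real.sqrt K * k ^ 3 * m ^ 12 / 2) * A + (3 * (Real.sqrt K * k ^ 3) / (2 * m ^ 4)) * B := by
          rw [hAa, hBb]
          ring
  have hθm : 0 ≤ 3 * (Real.sqrt K * k ^ 3) / (2 * m ^ 4) := by positivity
  have hBθ := mul_le_mul_of_nonneg_left hB hθm
  have e : 3 * (Real.sqrt K * k ^ 3) / (2 * m ^ 4) * ((1 + δ) * D + (1 + δ⁻¹) * ((c / R) ^ 2 * I)) =
      3 * (Real.sqrt K * k ^ 3) / (2 * m ^ 4) * (1 + δ) * D +
        3 * (Real.sqrt K * k ^ 3) / (2 * m ^ 4) * (1 + δ⁻¹) * (c / R) ^ 2 * I := by ring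
  rw [e] at hBθ
  linarith [hS, hmain, hBθ]

/-- **The stretching term against the squared cutoff, with free Young weight `m` and free product-rule
weight `δ`.** With `g = φ_R Ω`, `θ = √K_U(√K_S)³`: `2∫φ_R²⟪DU Ω, Ω⟫ ≤ 2‖DU‖₂‖g‖₄²`, Ladyzhenskaya,
`4ab³ ≤ m¹²a⁴ + 3b⁴/m⁴` and `‖Dg‖² ≤ (1+δ)φ_R²‖DΩ‖² + (1+δ⁻¹)‖Dφ_R‖²‖Ω‖²` give
`2∫φ_R²⟪DU Ω, Ω⟫ ≤ (θm¹²/2) Z_R + (3θ/(2m⁴))(1+δ)∫φ_R²‖∇Ω‖²_F + (3θ/(2m⁴))(1+δ⁻¹)(c₁/R)²∫_{B̄_{2R}}‖Ω‖²`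
(adapted from `two_mul_integral_sqCutoff_stretching_le`, `δ = 1`, `m = 1`). [folklore; Ladyzhenskaya's inequality] -/
theorem two_mul_integral_sqCutoff_stretching_le_weighted (hV : IsTypeIAncientMild C V) {c₁ : ℝ}
    (hc₁ : ∀ R : ℝ, 0 < R → ∀ y : (EuclideanSpace ℝ (Fin 3)),
      ‖fderiv ℝ (fun z : (EuclideanSpace ℝ (Fin 3)) => smoothTransition (2 - ‖z‖ ^ 2 / R ^ 2)) y‖ ≤ c₁ / R)
    {R : ℝ} (hR : 0 < R) (s : ℝ) {KU : ℝ}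
    (hint : Integrable (fun y => ‖fderiv ℝ (lerayOrbit V s) y‖ ^ 2))
    (hKU : ∫ y, ‖fderiv ℝ (lerayOrbit V s) y‖ ^ 2 ≤ KU) {δ m : ℝ} (hδ : 0 < δ) (hm : 0 < m) :
    2 * (∫ y, smoothTransition (2 - ‖y‖ ^ 2 / R ^ 2) ^ 2 *
        ⟪fderiv ℝ (lerayOrbit V s) y (lerayVorticity V s y), lerayVorticity V s y⟫) ≤
      (Real.sqrt KU * Real.sqrt (SNormLESNormFDerivOfEqConst (EuclideanSpace ℝ (Fin 3)) (volume : Measure (EuclideanSpace ℝ (Fin 3))) 2 : ℝ) ^ 3 * m ^ 12 / 2) *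
          (∫ y, smoothTransition (2 - ‖y‖ ^ 2 / R ^ 2) ^ 2 * ‖lerayVorticity V s y‖ ^ 2) +
        (3 * (Real.sqrt KU * Real.sqrt (SNormLESNormFDerivOfEqConst (EuclideanSpace ℝ (Fin 3)) (volume : Measure (EuclideanSpace ℝ (Fin 3))) 2 : ℝ) ^ 3) / (2 * m ^ 4)) * (1 + δ) *
          (∫ y, smoothTransition (2 - ‖y‖ ^ 2 / R ^ 2) ^ 2 *
            frobeniusNormSq (fderiv ℝ (lerayVorticity V s) y)) +
        (3 * (Real.sqrt KU * Real.sqrt (SNormLESNormFDerivOfEqConst (EuclideanSpace ℝ (Fin 3)) (volume : Measure (EuclideanSpace ℝ (Fin 3))) 2 : ℝ) ^ 3) / (2 * m ^ 4)) * (1 + δ⁻¹) *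
          (c₁ / R) ^ 2 * ∫ y in closedBall (0 : (EuclideanSpace ℝ (Fin 3))) (2 * R), ‖lerayVorticity V s y‖ ^ 2 := by
  set KS : ℝ := (SNormLESNormFDerivOfEqConst (EuclideanSpace ℝ (Fin 3)) (volume : Measure (EuclideanSpace ℝ (Fin 3))) 2 : ℝ) with hKSdef
  have hKS0 : 0 ≤ KS := NNReal.coe_nonneg _
  set φ : (EuclideanSpace ℝ (Fin 3)) → ℝ := fun z => smoothTransition (2 - ‖z‖ ^ 2 / R ^ 2) with hφdef
  set Ω := lerayVorticity V s with hΩdef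
  set U := lerayOrbit V s with hUdef
  have hφ1 : ContDiff ℝ 1 φ := contDiff_smoothTransition_cutoff (n := 1) R
  have hφ0 : ∀ y, 0 ≤ φ y := fun y => smoothTransition_cutoff_nonneg R y
  have hφz : ∀ y ∉ closedBall (0 : (EuclideanSpace ℝ (Fin 3))) (2 * R), φ y = 0 := fun y hy =>
    smoothTransition_cutoff_eq_zero_of_notMem hR hy
  have hφ2c : HasCompactSupport fun y : (EuclideanSpace ℝ (Fin 3)) => φ y ^ 2 := hasCompactSupport_sqCutoff hR
  have hΩ1 : ContDiff ℝ 1 Ω := signedBudget_contDiff_lerayVorticity_slice hV s (n := 1)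
  have hU1 : ContDiff ℝ 1 U := mustSqueeze_contDiff_lerayOrbit_slice hV s (n := 1)
  have hcΩ : Continuous Ω := hΩ1.continuous
  have hcDΩ : Continuous (fderiv ℝ Ω) := hΩ1.continuous_fderiv one_ne_zero
  have hcDU : Continuous (fderiv ℝ U) := hU1.continuous_fderiv one_ne_zero
  have hcφ : Continuous φ := hφ1.continuous
  have hcDφ : Continuous (fderiv ℝ φ) := hφ1.continuous_fderiv one_ne_zero
  have hcF : Continuous fun y => frobeniusNormSq (fderiv ℝ Ω y) :=
    continuous_frobeniusNormSq_fderiv_lerayVorticity hV s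
  have add_sq : ∀ p q : ℝ, (p + q) ^ 2 ≤ (1 + δ) * p ^ 2 + (1 + δ⁻¹) * q ^ 2 := fun p q => by
    have h : (1 + δ) * p ^ 2 + (1 + δ⁻¹) * q ^ 2 - (p + q) ^ 2 = (δ * p - q) ^ 2 / δ := by
      field_simp
      ring
    have h0 : 0 ≤ (δ * p - q) ^ 2 / δ := div_nonneg (sq_nonneg _) hδ.le
    linarith
  -- the test field `g = φ Ω`
  have hg1 : ContDiff ℝ 1 fun y => φ y • Ω y := hφ1.smul hΩ1
  have hcg : Continuous fun y => φ y • Ω y := hg1.continuous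
  have hcDg : Continuous (fderiv ℝ fun y => φ y • Ω y) := hg1.continuous_fderiv one_ne_zero
  have hg0 : ∀ y ∉ closedBall (0 : (EuclideanSpace ℝ (Fin 3))) (2 * R), φ y • Ω y = 0 := fun y hy => by
    rw [hφz y hy, zero_smul]
  have hgts : tsupport (fun y => φ y • Ω y) ⊆ closedBall (0 : (EuclideanSpace ℝ (Fin 3))) (2 * R) :=
    closure_minimal (fun y hy => by by_contra h; exact hy (hg0 y h)) isClosed_closedBall
  have hDg0 : ∀ y ∉ closedBall (0 : (EuclideanSpace ℝ (Fin 3))) (2 * R), fderiv ℝ (fun y => φ y • Ω y) y = 0 := fun y hy =>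
    fderiv_of_notMem_tsupport ℝ fun h => hy (hgts h)
  have hcs : ∀ {f : (EuclideanSpace ℝ (Fin 3)) → ℝ}, (∀ y ∉ closedBall (0 : (EuclideanSpace ℝ (Fin 3))) (2 * R), f y = 0) → HasCompactSupport f :=
    fun hf => HasCompactSupport.intro (isCompact_closedBall (0 : (EuclideanSpace ℝ (Fin 3))) (2 * R)) hf
  have hs2 : HasCompactSupport fun y => ‖φ y • Ω y‖ ^ 2 :=
    hcs fun y hy => by show ‖φ y • Ω y‖ ^ 2 = 0; rw [hg0 y hy]; simp
  have hs6 : HasCompactSupport fun y => ‖φ y • Ω y‖ ^ 6 :=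
    hcs fun y hy => by show ‖φ y • Ω y‖ ^ 6 = 0; rw [hg0 y hy]; simp
  have hsB : HasCompactSupport fun y => ‖fderiv ℝ (fun y => φ y • Ω y) y‖ ^ 2 :=
    hcs fun y hy => by show ‖fderiv ℝ (fun y => φ y • Ω y) y‖ ^ 2 = 0; rw [hDg0 y hy]; simp
  have hi2 : Integrable fun y => ‖φ y • Ω y‖ ^ 2 := (hcg.norm.pow 2).integrable_of_hasCompactSupport hs2
  have hi6 : Integrable fun y => ‖φ y • Ω y‖ ^ 6 := (hcg.norm.pow 6).integrable_of_hasCompactSupport hs6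
  have hiB : Integrable fun y => ‖fderiv ℝ (fun y => φ y • Ω y) y‖ ^ 2 :=
    (hcDg.norm.pow 2).integrable_of_hasCompactSupport hsB
  -- (1) Ladyzhenskaya
  have hL := integral_norm_pow_four_le_of_integrable (volume : Measure (EuclideanSpace ℝ (Fin 3))) finrank_euclideanSpace_fin
    hg1 hi2 hi6 hiB
  rw [← hKSdef] at hL
  set A : ℝ := ∫ y, ‖φ y • Ω y‖ ^ 2 with hAdef
  set B : ℝ := ∫ y, ‖fderiv ℝ (fun y => φ y • Ω y) y‖ ^ 2 with hBdef
  set I4 : ℝ := ∫ y, ‖φ y • Ω y‖ ^ 4 with hI4def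
  set Z : ℝ := ∫ y, φ y ^ 2 * ‖Ω y‖ ^ 2 with hZdef
  set D : ℝ := ∫ y, φ y ^ 2 * frobeniusNormSq (fderiv ℝ Ω y) with hDdef
  set I : ℝ := ∫ y in closedBall (0 : (EuclideanSpace ℝ (Fin 3))) (2 * R), ‖Ω y‖ ^ 2 with hIdef
  set J : ℝ := ∫ y, ‖fderiv ℝ U y‖ ^ 2 with hJdef
  have hA0 : 0 ≤ A := integral_nonneg fun y => by positivity
  have hB0 : 0 ≤ B := integral_nonneg fun y => by positivity
  have hI0 : 0 ≤ I := integral_nonneg fun y => by positivity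
  have hD0 : 0 ≤ D := integral_nonneg fun y => mul_nonneg (sq_nonneg _) (frobeniusNormSq_nonneg _)
  have hJ0 : 0 ≤ J := integral_nonneg fun y => by positivity
  have hKU0 : 0 ≤ KU := hJ0.trans hKU
  have hA12 : A ^ (1 / 2 : ℝ) = Real.sqrt A := by rw [Real.sqrt_eq_rpow]
  have hB32 : B ^ (3 / 2 : ℝ) = Real.sqrt B ^ 3 := by
    rw [Real.sqrt_eq_rpow, ← Real.rpow_natCast, ← Real.rpow_mul hB0]; norm_num
  rw [hA12, hB32] at hL
  -- `A = Z` (`‖φ Ω‖² = φ² ‖Ω‖²`)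
  have hAZ : A = Z := integral_congr_ae (Eventually.of_forall fun y => by
    show ‖φ y • Ω y‖ ^ 2 = φ y ^ 2 * ‖Ω y‖ ^ 2
    rw [norm_smul, Real.norm_of_nonneg (hφ0 y), mul_pow])
  -- (2) fourth roots: `√I4 ≤ k³ a b³`
  set k := Real.sqrt KS with hk
  set a := Real.sqrt (Real.sqrt A) with ha
  set b := Real.sqrt (Real.sqrt B) with hb
  have hk0 : 0 ≤ k := Real.sqrt_nonneg _
  have ha0 : 0 ≤ a := Real.sqrt_nonneg _
  have hb0 : 0 ≤ b := Real.sqrt_nonneg _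
  have hkK : k ^ 2 = KS := Real.sq_sqrt hKS0
  have hsA : a ^ 2 = Real.sqrt A := Real.sq_sqrt (Real.sqrt_nonneg A)
  have hsB : b ^ 2 = Real.sqrt B := Real.sq_sqrt (Real.sqrt_nonneg B)
  have hAa : A = a ^ 4 := by rw [show a ^ 4 = (a ^ 2) ^ 2 by ring, hsA, Real.sq_sqrt hA0]
  have hBb : B = b ^ 4 := by rw [show b ^ 4 = (b ^ 2) ^ 2 by ring, hsB, Real.sq_sqrt hB0]
  have hs4 : Real.sqrt I4 ≤ k ^ 3 * a * b ^ 3 := by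
    have h : I4 ≤ (k ^ 3 * a * b ^ 3) ^ 2 := by
      calc I4 ≤ KS ^ 3 * Real.sqrt A * Real.sqrt B ^ 3 := hL
        _ = (k ^ 3 * a * b ^ 3) ^ 2 := by rw [← hkK, ← hsA, ← hsB]; ring
    have := Real.sqrt_le_sqrt h
    rwa [Real.sqrt_sq (by positivity)] at this
  -- (3) Cauchy–Schwarz: `∫ ‖DU‖ ‖g‖² ≤ √J √I4`
  have hmem1 : MemLp (fun y => ‖fderiv ℝ U y‖) (ENNReal.ofReal 2) volume := by
    rw [ENNReal.ofReal_ofNat]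
    refine (memLp_two_iff_integrable_sq_norm hcDU.norm.aestronglyMeasurable).2 ?_
    exact hint.congr (Eventually.of_forall fun y => by simp only [norm_norm])
  have hmem2 : MemLp (fun y => ‖φ y • Ω y‖ ^ 2) (ENNReal.ofReal 2) volume := by
    rw [ENNReal.ofReal_ofNat]
    exact (hcg.norm.pow 2).memLp_of_hasCompactSupport hs2
  have hCS : ∫ y, ‖fderiv ℝ U y‖ * ‖φ y • Ω y‖ ^ 2 ≤ Real.sqrt J * Real.sqrt I4 := by
    have h := integral_mul_norm_le_Lp_mul_Lq Real.HolderConjugate.two_two hmem1 hmem2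
    have e0 : ∫ y, ‖‖fderiv ℝ U y‖‖ * ‖‖φ y • Ω y‖ ^ 2‖ = ∫ y, ‖fderiv ℝ U y‖ * ‖φ y • Ω y‖ ^ 2 :=
      integral_congr_ae (Eventually.of_forall fun y => by
        show ‖‖fderiv ℝ U y‖‖ * ‖‖φ y • Ω y‖ ^ 2‖ = ‖fderiv ℝ U y‖ * ‖φ y • Ω y‖ ^ 2
        rw [norm_norm, norm_pow, norm_norm])
    have e1 : ∫ y, ‖‖fderiv ℝ U y‖‖ ^ (2 : ℝ) = J := integral_congr_ae (Eventually.of_forall fun y => by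
      show ‖‖fderiv ℝ U y‖‖ ^ (2 : ℝ) = ‖fderiv ℝ U y‖ ^ 2
      rw [norm_norm, Real.rpow_two])
    have e2 : ∫ y, ‖‖φ y • Ω y‖ ^ 2‖ ^ (2 : ℝ) = I4 := integral_congr_ae (Eventually.of_forall fun y => by
      show ‖‖φ y • Ω y‖ ^ 2‖ ^ (2 : ℝ) = ‖φ y • Ω y‖ ^ 4
      rw [norm_pow, norm_norm, Real.rpow_two]; ring)
    rw [e0, e1, e2, ← Real.sqrt_eq_rpow, ← Real.sqrt_eq_rpow] at h
    exact h
  -- (4) the stretching integrand against `‖DU‖ ‖g‖²`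
  have hpt : ∀ y, φ y ^ 2 * ⟪fderiv ℝ U y (Ω y), Ω y⟫ ≤ ‖fderiv ℝ U y‖ * ‖φ y • Ω y‖ ^ 2 := by
    intro y
    have e : φ y ^ 2 * ⟪fderiv ℝ U y (Ω y), Ω y⟫ = ⟪fderiv ℝ U y (φ y • Ω y), φ y • Ω y⟫ := by
      rw [map_smul, real_inner_smul_left, real_inner_smul_right]; ring
    rw [e]
    calc ⟪fderiv ℝ U y (φ y • Ω y), φ y • Ω y⟫ ≤ ‖fderiv ℝ U y (φ y • Ω y)‖ * ‖φ y • Ω y‖ :=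
          real_inner_le_norm _ _
      _ ≤ ‖fderiv ℝ U y‖ * ‖φ y • Ω y‖ * ‖φ y • Ω y‖ :=
          mul_le_mul_of_nonneg_right (ContinuousLinearMap.le_opNorm _ _) (norm_nonneg _)
      _ = ‖fderiv ℝ U y‖ * ‖φ y • Ω y‖ ^ 2 := by ring
  have iS : Integrable fun y => φ y ^ 2 * ⟪fderiv ℝ U y (Ω y), Ω y⟫ :=
    ((hcφ.pow 2).mul ((hcDU.clm_apply hcΩ).inner hcΩ)).integrable_of_hasCompactSupport hφ2c.mul_right
  have iP : Integrable fun y => ‖fderiv ℝ U y‖ * ‖φ y • Ω y‖ ^ 2 :=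
    (hcDU.norm.mul (hcg.norm.pow 2)).integrable_of_hasCompactSupport
      (hcs fun y hy => by show ‖fderiv ℝ U y‖ * ‖φ y • Ω y‖ ^ 2 = 0; rw [hg0 y hy]; simp)
  have hS : (∫ y, φ y ^ 2 * ⟪fderiv ℝ U y (Ω y), Ω y⟫) ≤ Real.sqrt J * Real.sqrt I4 :=
    (integral_mono iS iP hpt).trans hCS
  -- (5) `B ≤ 2 D + 2 (c₁/R)² I`
  have hDg : ∀ y, ‖fderiv ℝ (fun y => φ y • Ω y) y‖ ^ 2 ≤ (1 + δ) * (φ y ^ 2 * frobeniusNormSq (fderiv ℝ Ω y)) +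
      (1 + δ⁻¹) * (‖fderiv ℝ φ y‖ ^ 2 * ‖Ω y‖ ^ 2) := by
    intro y
    have hdφ : DifferentiableAt ℝ φ y := hφ1.differentiable one_ne_zero y
    have hdΩ : DifferentiableAt ℝ Ω y := hΩ1.differentiable one_ne_zero y
    have e : fderiv ℝ (fun y => φ y • Ω y) y = φ y • fderiv ℝ Ω y + (fderiv ℝ φ y).smulRight (Ω y) :=
      (hdφ.hasFDerivAt.smul hdΩ.hasFDerivAt).fderiv
    have hn : ‖fderiv ℝ (fun y => φ y • Ω y) y‖ ≤ φ y * ‖fderiv ℝ Ω y‖ + ‖fderiv ℝ φ y‖ * ‖Ω y‖ := by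
      rw [e]
      refine (norm_add_le _ _).trans (add_le_add ?_ ?_)
      · rw [norm_smul, Real.norm_of_nonneg (hφ0 y)]
      · exact (ContinuousLinearMap.norm_smulRight_apply _ _).le
    have hop : ‖fderiv ℝ Ω y‖ ^ 2 ≤ frobeniusNormSq (fderiv ℝ Ω y) := sq_opNorm_le_frobeniusNormSq _
    have hop' : φ y ^ 2 * ‖fderiv ℝ Ω y‖ ^ 2 ≤ φ y ^ 2 * frobeniusNormSq (fderiv ℝ Ω y) :=
      mul_le_mul_of_nonneg_left hop (sq_nonneg _)
    have hδ1 : 0 ≤ 1 + δ := by linarith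
    calc ‖fderiv ℝ (fun y => φ y • Ω y) y‖ ^ 2
        ≤ (φ y * ‖fderiv ℝ Ω y‖ + ‖fderiv ℝ φ y‖ * ‖Ω y‖) ^ 2 :=
          pow_le_pow_left₀ (norm_nonneg _) hn 2
      _ ≤ (1 + δ) * (φ y * ‖fderiv ℝ Ω y‖) ^ 2 + (1 + δ⁻¹) * (‖fderiv ℝ φ y‖ * ‖Ω y‖) ^ 2 := add_sq _ _
      _ = (1 + δ) * (φ y ^ 2 * ‖fderiv ℝ Ω y‖ ^ 2) + (1 + δ⁻¹) * (‖fderiv ℝ φ y‖ ^ 2 * ‖Ω y‖ ^ 2) := by ring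
      _ ≤ (1 + δ) * (φ y ^ 2 * frobeniusNormSq (fderiv ℝ Ω y)) + (1 + δ⁻¹) * (‖fderiv ℝ φ y‖ ^ 2 * ‖Ω y‖ ^ 2) := by
          have := mul_le_mul_of_nonneg_left hop' hδ1
          linarith
  have iD : Integrable fun y => φ y ^ 2 * frobeniusNormSq (fderiv ℝ Ω y) :=
    ((hcφ.pow 2).mul hcF).integrable_of_hasCompactSupport hφ2c.mul_right
  have hDφ0 : ∀ y ∉ closedBall (0 : (EuclideanSpace ℝ (Fin 3))) (2 * R), ‖fderiv ℝ φ y‖ ^ 2 = 0 := fun y hy => by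
    rw [hφdef, signedBudget_fderiv_cutoff_eq_zero hR hy, norm_zero]; ring
  have iC : Integrable fun y => ‖fderiv ℝ φ y‖ ^ 2 * ‖Ω y‖ ^ 2 :=
    ((hcDφ.norm.pow 2).mul (hcΩ.norm.pow 2)).integrable_of_hasCompactSupport
      (hcs fun y hy => by show ‖fderiv ℝ φ y‖ ^ 2 * ‖Ω y‖ ^ 2 = 0; rw [hDφ0 y hy, zero_mul])
  have hcollar : (∫ y, ‖fderiv ℝ φ y‖ ^ 2 * ‖Ω y‖ ^ 2) ≤ (c₁ / R) ^ 2 * I := by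
    refine (le_abs_self _).trans (abs_integral_le_of_weight_sq hcΩ (w := fun y => ‖fderiv ℝ φ y‖ ^ 2)
      (hcDφ.norm.pow 2) hDφ0 (fun y _ => ?_) (fun y => ?_))
    · exact pow_le_pow_left₀ (norm_nonneg _) (hc₁ R hR y) 2
    · rw [abs_of_nonneg (by positivity)]
  have hδi : 0 ≤ 1 + δ⁻¹ := by positivity
  have hB : B ≤ (1 + δ) * D + (1 + δ⁻¹) * ((c₁ / R) ^ 2 * I) := by
    calc B ≤ ∫ y, ((1 + δ) * (φ y ^ 2 * frobeniusNormSq (fderiv ℝ Ω y)) +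
          (1 + δ⁻¹) * (‖fderiv ℝ φ y‖ ^ 2 * ‖Ω y‖ ^ 2)) :=
          integral_mono hiB ((iD.const_mul (1 + δ)).add (iC.const_mul (1 + δ⁻¹))) hDg
      _ = (1 + δ) * D + (1 + δ⁻¹) * ∫ y, ‖fderiv ℝ φ y‖ ^ 2 * ‖Ω y‖ ^ 2 := by
          rw [integral_add (iD.const_mul (1 + δ)) (iC.const_mul (1 + δ⁻¹)), integral_const_mul,
            integral_const_mul]
      _ ≤ (1 + δ) * D + (1 + δ⁻¹) * ((c₁ / R) ^ 2 * I) := by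
          have := mul_le_mul_of_nonneg_left hcollar hδi
          linarith
  -- (6) assemble with the WEIGHTED Young inequality `4ab³ ≤ m¹²a⁴ + 3b⁴/m⁴` (scalar lemma)
  rw [← hAZ]
  exact two_mul_le_of_weightedYoung hk0 ha0 hb0 hm hS hs4 (Real.sqrt_le_sqrt hKU) hAa hBb hB

end Summit.NavierStokesRegularity.NavierStokesRegularity.Theorems.SmallDissipationGap

end
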